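import Summits.QuantumFields.BalabanUV.T4Continuum.Spine.NE1p.DressedSmallFieldContourWitness

/-!
# T⁴ programme, spine estimate NE1′ (node O3b/H2) — WITNESS: THE CUBE LETTERS OF (2.14) EARN (B3)'s DECAY — print's first factor of (2.15),
# `exp(−(κ₁ − 1)·#cubes)`, BY CAUCHY AT RADIUS `e^{κ₁}` on the NE5 substrate's contour objects; N0k's END fires on W23's two-cube catalogue
# with the (2.38)-shape socket `hL3` DERIVED (rate `R = κ₁ − 1`, d-free bare constant) for EVERY family of table-free cube factors entire and
# bounded by `1` ON the `σ(Δ)`-circle — not chosen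

Cell `pub-balaban`, sub-cell `t4`, row NE1′ formalisation crew (`t4/formal/NE1p/LEAVES.md` row W34 ∕ DAG N29zn; own-initiative witness under typer
R-T61 (ii), INTENT journal l.16588, BOOKED R-T110 (vi-b) l.16701, owner g27 «GO» l.16631), unit `b2b-balaban-t4-ne1p-formalise-leaf-08` (gen 9).  ADDITIVE — imports W29
`Spine/NE1p/DressedSmallFieldContourWitness` ONLY (leaf-08 g8, p223477; through it the NE5 substrate `Support/B13TermContours` (`lam₁`, `w₁`, `wB₁`,
`circ`, `setIntegral_w₁_mul_eq_deriv`, `integral_w₁_mul_eq_sub` BY NAME), owner node N0k `DressedSmallFieldShape` (p220184), W23's catalogue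
(p221160), W25 (p222160)); toy DATA `def`s + theorems; 0 `def … : Prop`, 0 cite, 0 sorry; nothing of N0k∕W23∕W25∕W29∕the substrate restated.

WHY THIS FILE.  N0k's END `muPart_locE_le_of_linearDressing` carries the (2.38)-SHAPE socket (B3) `hL3 : Σ_{j∈terms Z} ∫‖pre_j‖·e^{l_j R₀}dν_j ≤
A·e^{−R·d(Z)}`.  In every inhabitant so far the decay is PLANTED in the prefactor constant (W23 `hL3₂ := le_rfl`; W27 `hL3_G` ∕ W29 `hL3_M` «toy-true
BY CHOICE», W29's `cM Z := m₂ Z∕(2e^{1∕2})` carrying `e^{−5 d Z}` by hand).  Print EARNS it: [Balaban1988RGII] p. 14 (2.8) writes the activity as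
decoupling derivatives «Π_{Δ⊂Z∖Z̃′₀} ∫₀¹ ds(Δ) ∂∕∂s(Δ)» of an expression whose table-free factors are «an analytic function of s(Y₀), B, for
|s(Y₀)| ≤ e^{κ₁}» (p. 6, last paragraph), represents «all derivatives by the Cauchy formula» with «the σ(Δ)-integrations … over the circles
|σ(Δ)| = e^{κ₁}» (p. 7 (1.23); p. 15 (2.14)), and reads off «exp(−(κ₁ − 1)M⁻⁴|Y₀∖□̃⁴|)» (p. 7 (1.24)) ∕ «exp(−(κ₁ − 1)(LM)⁻⁴|Z∖Z′₀|) Π_{Y∈𝐃}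
2∕|τ(Y)|» (p. 15 (2.15)), converting volume into tree length in (1.25) — LOCI of the audited manuscript, TYPE∕CONTEXT only.  Here that
MECHANISM is kernel-checked on the substrate's contour objects and fed to N0k:
* §1 THE CUBE LETTER: the `θ`-integral of the weight at radius `e^{κ₁}` against a table-free factor `F` IS the decoupling derivative `∂F∕∂s`
  (`setIntegral_w₁_mul_eq_deriv` BY NAME, first NE1′ use), the letter reproduces `F 1 − F 0`, a factor bounded by `B` ON THE CIRCLE costs
  `≤ e^{κ₁}∕(e^{κ₁}−1)²·B`; print's per-letter factors LOCATED as arithmetic of the weight letter `2π·wB₁ r = r∕(r−1)²`: **`decouplingFactor_le :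
  1 ≤ κ₁ → e^{κ₁}∕(e^{κ₁}−1)² ≤ e^{−(κ₁−1)}`** (true threshold `κ₁ ≳ 0.933`) and `polymerFactor_le : 7∕2 ≤ r → r∕(r−1)² ≤ 2∕r` («2∕|τ(Y)|»).
* §2 ONE (2.14)-SHAPE TERM PER POLYMER `Z` OF W23's CATALOGUE CARRYING BOTH LETTERS: `ω = (p, q)`, one `(s,σ)`-pair `p Δ` per cube, one
  `(t,τ)`-pair `q`; measure `νK Z = (⨂_Δ μc Z Δ) ⊗ lam₁`, `μc Z Δ = lam₁` on the cubes OF `Z`, a Dirac filler outside (the parameter measure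
  GENUINELY indexed by the polymer); prefactor `preK = cK·(Π_{Δ∈cubes₂ Z} w₁(e^{κ₁})(p Δ)·G Δ(σ_Δ))·w₁ 2 q` for ANY family `G` of table-free cube
  factors (`hG` entire, `hB` bounded by `1` on the circle), functional = W29's Mayer letter `linC 2 (ev Z) q`, d-FREE bare constant
  `cK = 1∕(24e^{1∕2})`; the activity `actK G s Z = cK·Π_{Δ∈cubes₂ Z}(G Δ 1 − G Δ 0)·(e^{(V₀M + s•OM) Z} − 1)` is RADIUS-FREE and (B1) `hrep_K`
  represents it at EVERY radius `κ₁ > 0` (Fubini × §1 per cube × W29 `cauchyLetter_rep`); **`hL3_K` DERIVED for all `κ₁ ≥ 1`, all admissible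
  `G`**: each cube letter pays `e^{−(κ₁−1)}`, `#cubes₂ Z = d₂ Z + 1` (volume ⇒ tree length, (1.25) KIND), the polymer letter pays `2e^{1∕2}`.
* §3 N0k's END FIRES ONCE BY NAME for all `κ₁ ≥ 6` (located largeness: `hrate : 1 + 2·1 + 2 ≤ κ₁ − 1` at W23's numerals) and all admissible
  `G`, W23's sockets and `envelope₂_eq` BY NAME: `‖E_μ(univ) − E_0(univ)‖ ≤ (3∕16)·μ₀∕(1−μ₀)`.
* §4 GENUINE on the DECIDED one-step factor `Gstep κ₁ Δ σ = e^{−κ₁}·σ` (`‖·‖ = 1` ON the circle — `hB` TIGHT; the letter reproduces the coupling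
  `e^{−κ₁}` through `Δ`, the majorant pays `e^{−(κ₁−1)}`: print's loss `e` per cube): the μ-part is NOT zero (W25 `exp_locE_univ` BY NAME).

HONEST FRAMING (typer R-T110 (vi-b)(g) wording + the owner's keep-sentence l.16631, verbatim in substance).  ONE printed MECHANISM of
[Balaban1988RGII] (2.15) — analytic & bounded by 1 on the big σ-circle ⇒ decay `e^{−(κ₁−1)}` per cube — exercised IN KERNEL on the NE5 substrate's
CONTOUR OBJECTS over W23's decided two-cube catalogue, for a CLASS of table-free entire factors ([folklore] complex analysis through the substrate's
checked dictionary; Fubini on `Measure.pi`∕`Measure.prod`; located real arithmetic); the bound-by-1 ON the circle is the toy's HYPOTHESIS `hB`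
(print's (1.21)∕(1.18) TYPE); the identification of `G Δ` with print's s(Δ)-dependent operator factors and of `e^{κ₁}` with (1.22)∕(1.23)'s circle is
a TYPE READING; the thresholds `κ₁ ≥ 1` ∕ `κ₁ ≥ 6` ∕ `r ≥ 7∕2` are OUR arithmetic on OUR majorant shapes and W23's numerals — no numeral of print
asserted (k2); (B1) for Bałaban's (2.14) NOT discharged; (B3) for Bałaban's tables = GAPS G-ne9p2-5 UNPRINTED (shared with row NE9) — NOT discharged,
untouched; (B5) untouched; 0 binders instantiated on Bałaban's densities ∕ operators ∕ (2.14) data ∕ `d_k` ∕ minimisers ∕ backgrounds; discharges no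
wall item; R-t4r2-Q2 NOT met thereby; NE1′ ⇐ the named binders — NOT proved, NOT printed; spine PROVED 0∕9; count 9 unchanged.  Rung (B)+1 on ONE
finite four-torus — NOT infinite volume, NOT a mass gap, NOT OS on ℝ⁴, NOT Clay.  ABSOLUTE RULE honoured: the quotations are LOCI of the audited
manuscript [Balaban1988RGII] (CMP 116 (1988) 1–22, pp. 6, 7, 14, 15; renders `b2b-balaban-ref1/pages/1988-cmp116-rg-II-cluster/…-p006∕p007∕p013∕
p014∕p015-x2.png` read as images this generation), TYPE∕CONTEXT only, never hypothesis-free facts; nothing internally minted is cited; [folklore]∕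
[arith] tags on kernel lemmas only.  HONEST DEPENDENCY: continuum YM on T⁴ ⇐ BetaPertH ∧ nine spine estimates (0/9 proved); BetaPertH ⇐ (D1) ∧
(D4) ∧ CAP+tail; G-an2-4 gates asym, D1 and NE2/3/4.
-/

noncomputable section

namespace Summit.QuantumFields.BalabanUV.T4Continuum.NE1p.DressedSmallFieldCubeLetterWitness

open MeasureTheory Metric Set Complex Finset
open scoped BigOperators Function
open Summit.QuantumFields.BalabanUV.T4Continuum.B13TermContours
open Literature.MathematicalPhysics.QuantumFieldTheory.Balaban1983to89.B13Resummation (locE)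
open Literature.Probability.LatticeModels (polyInc)
open Summit.QuantumFields.BalabanUV.T4Continuum.NE1p.DressedSmallFieldShape (muPart_locE_le_of_linearDressing)
open Summit.QuantumFields.BalabanUV.T4Continuum.NE1p.DressedSmallFieldPencilWitness
  (Pol cubes₂ d₂ hloc₂ hd₂ h126₂ hvol₂ h227₂ hsmall₂ envelope₂_eq)
open Summit.QuantumFields.BalabanUV.T4Continuum.NE1p.DressedSmallFieldInductionWitness (exp_locE_univ)
open Summit.QuantumFields.BalabanUV.T4Continuum.NE1p.DressedSmallFieldContourWitness
  (linC linC_apply hint_C majorant_C_le cauchyLetter_rep ev ev_apply oR V₀M OM oR_mem norm_V₀M_le norm_OM_le hl_M)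
open DressedSmallFieldPencilWitness.Pol

variable {G : Fin 2 → ℂ → ℂ} {κ₁ : ℝ}

/-! ## §1 THE CUBE LETTER: one `σ(Δ)`-contour at radius `e^{κ₁}` on a table-free factor -/

/-- [folklore] The `σ(Δ)`-circle lies outside the unit disc: `1 < e^{κ₁}` for `0 < κ₁`. -/
theorem one_lt_rexp (hκ : 0 < κ₁) : 1 < Real.exp κ₁ := Real.one_lt_exp_iff.2 hκ

/-- **THE INNER `σ(Δ)`-CONTOUR IS THE DECOUPLING DERIVATIVE `∂∕∂s(Δ)`** ((2.8) p. 14 ↔ (1.23) p. 7 ∕ (2.14) p. 15, TYPE; the substrate's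
`setIntegral_w₁_mul_eq_deriv` BY NAME — first NE1′ use): for `F` entire and `s ∈ [0,1]`, `∫_{θ∈[0,2π]} w₁(e^{κ₁})(s,θ)·F(σ_θ) dθ = F′(s)`. [folklore] -/
theorem cubeLetter_inner_eq_deriv (hκ : 0 < κ₁) {F : ℂ → ℂ} (hF : Differentiable ℂ F) {s : ℝ} (h0 : 0 ≤ s) (h1 : s ≤ 1) :
    ∫ θ in Icc 0 (2 * Real.pi), w₁ (Real.exp κ₁) (s, θ) * F (circ (Real.exp κ₁) θ) = deriv F s :=
  setIntegral_w₁_mul_eq_deriv (one_lt_rexp hκ) isOpen_univ (Set.subset_univ _) hF.differentiableOn h0 h1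

/-- **THE CUBE LETTER REPRODUCES `∫₀¹ ds ∂F∕∂s = F(1) − F(0)`** (substrate `integral_w₁_mul_eq_sub` BY NAME at radius `e^{κ₁}`). [folklore] -/
theorem cubeLetter_rep (hκ : 0 < κ₁) {F : ℂ → ℂ} (hF : Differentiable ℂ F) :
    ∫ x, w₁ (Real.exp κ₁) x * F (circ (Real.exp κ₁) x.2) ∂lam₁ = F 1 - F 0 :=
  integral_w₁_mul_eq_sub (one_lt_rexp hκ) isOpen_univ (Set.subset_univ _) hF.differentiableOn

/-- **THE CUBE LETTER'S (2.15)-MAJORANT** [folklore]: a factor bounded by `B` ON THE CIRCLE of radius `r > 1` costs `≤ r∕(r − 1)²·B` (the weight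
letter `2π·wB₁ r`, W29 `hint_C`∕`majorant_C_le` at exponent `0`) — print bounds the decoupling derivative by analyticity on the big circle. -/
theorem cubeLetter_majorant_le {r B : ℝ} (hr : 1 < r) {F : ℂ → ℂ} (hB : ∀ θ, ‖F (circ r θ)‖ ≤ B) :
    ∫ x, ‖w₁ r x * F (circ r x.2)‖ ∂lam₁ ≤ r / (r - 1) ^ 2 * B := by
  have hi : Integrable (fun x => ‖w₁ r x‖) lam₁ := by simpa using hint_C hr 0
  have hle : ∫ x, ‖w₁ r x‖ ∂lam₁ ≤ r / (r - 1) ^ 2 := by simpa using majorant_C_le hr 0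
  calc ∫ x, ‖w₁ r x * F (circ r x.2)‖ ∂lam₁ ≤ ∫ x, ‖w₁ r x‖ * B ∂lam₁ :=
        integral_mono_of_nonneg (Filter.Eventually.of_forall fun _ => norm_nonneg _) (hi.mul_const B)
          (Filter.Eventually.of_forall fun x => (norm_mul_le _ _).trans (mul_le_mul_of_nonneg_left (hB x.2) (norm_nonneg _)))
    _ ≤ r / (r - 1) ^ 2 * B := by
        rw [integral_mul_const]; exact mul_le_mul_of_nonneg_right hle ((norm_nonneg _).trans (hB 0))

/-- **(2.15)'s FIRST FACTOR, PER CUBE, LOCATED** [arith]: for `1 ≤ κ₁`, `e^{κ₁}∕(e^{κ₁} − 1)² ≤ e^{−(κ₁ − 1)}` — the weight letter at radius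
`e^{κ₁}` IS print's «exp(−(κ₁ − 1)·#cubes)» per cube ((1.24) p. 7 ∕ (2.15) p. 15, TYPE); true threshold `e^{κ₁} ≥ √e∕(√e − 1) ≈ 2.54`, the
proof runs through `√e ≥ 1.6487` (Mathlib `Real.exp_one_gt_d9`). -/
theorem decouplingFactor_le (hκ : 1 ≤ κ₁) : Real.exp κ₁ / (Real.exp κ₁ - 1) ^ 2 ≤ Real.exp (-(κ₁ - 1)) := by
  set y := Real.exp (1 / 2) with hy_def
  set E := Real.exp κ₁ with hE_def
  have hy2 : y * y = Real.exp 1 := by rw [hy_def, ← Real.exp_add]; norm_num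
  have hy : 1.6487 ≤ y := by nlinarith [Real.exp_one_gt_d9, hy2, Real.exp_pos (1 / 2 : ℝ)]
  have hE : y * y ≤ E := by rw [hy2, hE_def]; exact Real.exp_le_exp.2 hκ
  have h1 : 1 ≤ y * (y - 1) := by nlinarith [mul_nonneg (sub_nonneg.2 hy) (show (0 : ℝ) ≤ y + 0.6487 by linarith)]
  have h2 : E ≤ y * (E - 1) := by nlinarith [mul_le_mul_of_nonneg_right hE (show (0 : ℝ) ≤ y - 1 by linarith)]
  have h4 : E * E ≤ y * (E - 1) * (y * (E - 1)) := mul_le_mul h2 h2 (by linarith) (by nlinarith)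
  rw [show -(κ₁ - 1) = 1 - κ₁ by ring, Real.exp_sub, ← hy2, div_le_div_iff₀ (pow_pos (by nlinarith) 2) (by nlinarith)]
  nlinarith [h4]

/-- **… TO ANY NUMBER OF CUBES** [arith]: `(e^{κ₁}∕(e^{κ₁} − 1)²)ⁿ ≤ e^{−(κ₁ − 1)·n}` for `1 ≤ κ₁`. -/
theorem decouplingFactor_pow_le (hκ : 1 ≤ κ₁) (n : ℕ) :
    (Real.exp κ₁ / (Real.exp κ₁ - 1) ^ 2) ^ n ≤ Real.exp (-((κ₁ - 1) * n)) := by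
  calc (Real.exp κ₁ / (Real.exp κ₁ - 1) ^ 2) ^ n ≤ Real.exp (-(κ₁ - 1)) ^ n :=
        pow_le_pow_left₀ (by positivity) (decouplingFactor_le hκ) n
    _ = Real.exp (-((κ₁ - 1) * n)) := by rw [← Real.exp_nat_mul]; ring_nf

/-- **(2.15)'s SECOND FACTOR, PER POLYMER, LOCATED** [arith]: for `7∕2 ≤ r`, `r∕(r − 1)² ≤ 2∕r` — the weight letter at the polymer radius
`r = |τ(Y)|` IS print's «Π_{Y∈𝐃} 2∕|τ(Y)|» per polymer ((2.15) p. 15, TYPE); true threshold `2 + √2`. -/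
theorem polymerFactor_le {r : ℝ} (hr : 7 / 2 ≤ r) : r / (r - 1) ^ 2 ≤ 2 / r := by
  rw [div_le_div_iff₀ (pow_pos (by linarith) 2) (by linarith)]
  nlinarith [mul_nonneg (sub_nonneg.2 hr) (show (0 : ℝ) ≤ r - 1 / 2 by linarith)]

/-! ## §2 ONE (2.14)-SHAPE TERM PER POLYMER OF W23's TWO-CUBE CATALOGUE, CARRYING BOTH LETTERS -/

/-- THE PARAMETER MEASURE PER CUBE COORDINATE of polymer `Z`'s term: the cubes OF `Z` carry the `(s,σ)`-space `lam₁` (print's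
«Π_{Δ⊂Z∖Z̃′₀} ∫₀¹ds(Δ) (2πi)⁻¹∮dσ(Δ)», TYPE), the cube outside `Z` no parameter (Dirac filler). -/
def μc (Z : Pol) (Δ : Fin 2) : Measure (ℝ × ℝ) := if Δ ∈ cubes₂ Z then lam₁ else Measure.dirac 0

/-- [folklore] Every coordinate measure is finite. -/
instance isFiniteMeasure_μc (Z : Pol) (Δ : Fin 2) : IsFiniteMeasure (μc Z Δ) := by unfold μc; split_ifs <;> infer_instance

/-- THE TERM'S PARAMETER MEASURE `νK Z := (⨂_Δ μc Z Δ) ⊗ lam₁` on `ω = (p, q)` (cube letters `p`, polymer letter `q`), indexed by `Z`. -/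
def νK (Z : Pol) : Measure ((Fin 2 → ℝ × ℝ) × (ℝ × ℝ)) := (Measure.pi (μc Z)).prod lam₁

/-- [folklore] It is finite. -/
instance isFiniteMeasure_νK (Z : Pol) : IsFiniteMeasure (νK Z) := by unfold νK; infer_instance

/-- THE PER-CUBE FACTOR: on a cube OF `Z`, the Cauchy weight at radius `e^{κ₁}` times the table-free factor `G Δ` AT the contour value
`σ_Δ = circ (e^{κ₁}) θ_Δ`; `1` on the cube outside `Z`. -/
def cf (G : Fin 2 → ℂ → ℂ) (κ₁ : ℝ) (Z : Pol) (Δ : Fin 2) (x : ℝ × ℝ) : ℂ :=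
  if Δ ∈ cubes₂ Z then w₁ (Real.exp κ₁) x * G Δ (circ (Real.exp κ₁) x.2) else 1

/-- THE BARE CONSTANT `cK := 1∕(24·e^{1∕2})` — d-FREE: no decay is planted in the prefactor. -/
def cK : ℝ := 1 / (24 * Real.exp (1 / 2))

/-- [folklore] `0 < cK`. -/
theorem cK_pos : 0 < cK := by unfold cK; positivity

/-- THE PREFACTOR of polymer `Z`'s term: `cK·(Π_Δ cf_Δ(p Δ))·w₁ 2 q = cK·(Π_{Δ∈cubes₂ Z} w₁(e^{κ₁})(p Δ)·G Δ(σ_Δ))·w₁ 2 q` — μ-free. -/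
def preK (G : Fin 2 → ℂ → ℂ) (κ₁ : ℝ) (Z : Pol) (ω : (Fin 2 → ℝ × ℝ) × (ℝ × ℝ)) : ℂ :=
  (cK : ℂ) * (∏ Δ, cf G κ₁ Z Δ (ω.1 Δ)) * w₁ 2 ω.2

/-- [folklore] The cube part of the prefactor IS the product over the cubes OF `Z` (print's «Π_{Δ⊂Z∖Z̃′₀}», TYPE). -/
theorem prod_cf_eq (G : Fin 2 → ℂ → ℂ) (κ₁ : ℝ) (Z : Pol) (p : Fin 2 → ℝ × ℝ) :
    ∏ Δ, cf G κ₁ Z Δ (p Δ) = ∏ Δ ∈ cubes₂ Z, w₁ (Real.exp κ₁) (p Δ) * G Δ (circ (Real.exp κ₁) (p Δ).2) := by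
  simp only [cf, Finset.prod_ite_mem, Finset.univ_inter]

/-- THE FUNCTIONAL of polymer `Z`'s term: W29's Mayer letter `τ(q) • ev Z` at radius `2` — the TABLE is read only through the polymer letter. -/
def linK (Z : Pol) (ω : (Fin 2 → ℝ × ℝ) × (ℝ × ℝ)) : (Pol → ℂ) →L[ℂ] ℂ := linC 2 (ev Z) ω.2

/-- THE ACTIVITY IN CLOSED FORM, RADIUS-FREE: `actK G s Z := cK·(Π_{Δ∈cubes₂ Z}(G Δ 1 − G Δ 0))·(e^{(V₀M + s•OM) Z} − 1)` — the decoupling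
differences of the table-free factors through the cubes of `Z` times the Mayer factor of the dressed table entry. -/
def actK (G : Fin 2 → ℂ → ℂ) (s : ℂ) (Z : Pol) : ℂ :=
  (cK : ℂ) * (∏ Δ ∈ cubes₂ Z, (G Δ 1 - G Δ 0)) * (cexp ((V₀M + s • OM) Z) - 1)

/-- [folklore] Each per-cube factor is measurable (the table-free factor is continuous, being entire). -/
theorem measurable_cf (hG : ∀ Δ, Differentiable ℂ (G Δ)) (Z : Pol) (Δ : Fin 2) : Measurable (cf G κ₁ Z Δ) := by
  unfold cf; split_ifs
  · exact (measurable_w₁ _).mul ((hG Δ).continuous.measurable.comp ((measurable_circ _).comp measurable_snd))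
  · exact measurable_const

/-- Socket `hpre` of N0k: the prefactor is measurable. [folklore] -/
theorem hpre_K (hG : ∀ Δ, Differentiable ℂ (G Δ)) (Z : Pol) : AEStronglyMeasurable (preK G κ₁ Z) (νK Z) :=
  ((measurable_const.mul (Finset.measurable_prod _ fun Δ _ => (measurable_cf hG Z Δ).comp ((measurable_pi_apply Δ).comp
    measurable_fst))).mul ((measurable_w₁ 2).comp measurable_snd)).aestronglyMeasurable

/-- Socket `hlinw` of N0k. [folklore] -/
theorem hlinw_K (Z : Pol) (Q : Pol → ℂ) : AEStronglyMeasurable (fun ω => linK Z ω Q) (νK Z) := by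
  have h : Measurable fun ω : (Fin 2 → ℝ × ℝ) × (ℝ × ℝ) => circ 2 ω.2.2 * Q Z :=
    ((measurable_circ 2).comp (measurable_snd.comp measurable_snd)).mul_const _
  exact h.aestronglyMeasurable.congr (Filter.Eventually.of_forall fun ω => by simp [linK])

/-- Socket `hl` of N0k with the CONSTANT bound `2` (W29 `hl_M`). [folklore] -/
theorem hl_K (Z : Pol) (ω : (Fin 2 → ℝ × ℝ) × (ℝ × ℝ)) : ‖linK Z ω‖ ≤ 2 := hl_M Z ω.2

/-- **THE CUBE COORDINATES INTEGRATE OUT LETTER BY LETTER** [folklore]: `G Δ 1 − G Δ 0` on a cube OF `Z` (§1), `1` (Dirac filler) outside. -/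
theorem integral_cf (hκ : 0 < κ₁) (hG : ∀ Δ, Differentiable ℂ (G Δ)) (Z : Pol) (Δ : Fin 2) :
    ∫ x, cf G κ₁ Z Δ x ∂(μc Z Δ) = if Δ ∈ cubes₂ Z then G Δ 1 - G Δ 0 else 1 := by
  unfold cf μc; split_ifs with h
  · exact cubeLetter_rep hκ (hG Δ)
  · simp

/-- **(B1) `hrep` FOR THE TWO-LETTER TERM IS A THEOREM, AT EVERY RADIUS** (kernel; Fubini `integral_prod_mul` × `integral_fintype_prod_eq_prod`,
§1 per cube, W29 `cauchyLetter_rep`): for every `κ₁ > 0`, every family of entire table-free factors and every source `s`,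
`actK G s Z = Σ_{j∈{Z}} ∫ preK_j(ω)·exp(ℓ_{j,ω}(V₀M + s•OM)) dνK_j(ω)` — N0k's displayed (2.14)-shape; the radius is the representer's to choose. -/
theorem hrep_K (hκ : 0 < κ₁) (hG : ∀ Δ, Differentiable ℂ (G Δ)) (s : ℂ) (Z : Pol) :
    actK G s Z = ∑ j ∈ ({Z} : Finset Pol), ∫ ω, preK G κ₁ j ω * cexp (linK j ω (V₀M + s • OM)) ∂(νK j) := by
  rw [Finset.sum_singleton]
  have h1 : ∀ ω : (Fin 2 → ℝ × ℝ) × (ℝ × ℝ), preK G κ₁ Z ω * cexp (linK Z ω (V₀M + s • OM)) =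
      ((cK : ℂ) * ∏ Δ, cf G κ₁ Z Δ (ω.1 Δ)) * (w₁ 2 ω.2 * cexp (linC 2 (ev Z) ω.2 (V₀M + s • OM))) := fun ω => by
    simp only [preK, linK]; ring
  simp_rw [h1]
  rw [νK, integral_prod_mul (f := fun p : Fin 2 → ℝ × ℝ => (cK : ℂ) * ∏ Δ, cf G κ₁ Z Δ (p Δ))
    (g := fun q : ℝ × ℝ => w₁ 2 q * cexp (linC 2 (ev Z) q (V₀M + s • OM))), cauchyLetter_rep one_lt_two, ev_apply,
    integral_const_mul, integral_fintype_prod_eq_prod (𝕜 := ℂ) (fun Δ x => cf G κ₁ Z Δ x)]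
  simp_rw [integral_cf hκ hG]
  rw [Finset.prod_ite_mem, Finset.univ_inter, actK]

/-- [folklore] Pointwise size of a per-cube factor when the table-free factor is bounded by `1` ON the circle: `≤ max (wB₁ e^{κ₁}) 1`. -/
theorem norm_cf_le (hκ : 0 < κ₁) (hB : ∀ Δ θ, ‖G Δ (circ (Real.exp κ₁) θ)‖ ≤ 1) (Z : Pol) (Δ : Fin 2) (x : ℝ × ℝ) :
    ‖cf G κ₁ Z Δ x‖ ≤ max (wB₁ (Real.exp κ₁)) 1 := by
  unfold cf; split_ifs
  · exact (norm_mul_le _ _).trans (((mul_le_mul (norm_w₁_le (one_lt_rexp hκ) x) (hB Δ x.2) (norm_nonneg _)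
      (wB₁_nonneg (Real.exp_pos _).le)).trans_eq (mul_one _)).trans (le_max_left _ _))
  · rw [norm_one]; exact le_max_right _ _

/-- [folklore] Pointwise size of the prefactor: `‖preK‖ ≤ cK·(max (wB₁ e^{κ₁}) 1)²·wB₁ 2`. -/
theorem norm_preK_le (hκ : 0 < κ₁) (hB : ∀ Δ θ, ‖G Δ (circ (Real.exp κ₁) θ)‖ ≤ 1) (Z : Pol) (ω : (Fin 2 → ℝ × ℝ) × (ℝ × ℝ)) :
    ‖preK G κ₁ Z ω‖ ≤ cK * (max (wB₁ (Real.exp κ₁)) 1) ^ 2 * wB₁ 2 := by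
  rw [preK, norm_mul, norm_mul, Complex.norm_real, Real.norm_of_nonneg cK_pos.le, norm_prod]
  have h0 : (0 : ℝ) ≤ max (wB₁ (Real.exp κ₁)) 1 := zero_le_one.trans (le_max_right _ _)
  have h1 : ∏ Δ, ‖cf G κ₁ Z Δ (ω.1 Δ)‖ ≤ (max (wB₁ (Real.exp κ₁)) 1) ^ 2 := by
    calc ∏ Δ, ‖cf G κ₁ Z Δ (ω.1 Δ)‖ ≤ ∏ _Δ : Fin 2, max (wB₁ (Real.exp κ₁)) 1 :=
          Finset.prod_le_prod (fun _ _ => norm_nonneg _) fun Δ _ => norm_cf_le hκ hB Z Δ _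
      _ = (max (wB₁ (Real.exp κ₁)) 1) ^ 2 := by rw [Finset.prod_const, Finset.card_univ, Fintype.card_fin]
  exact mul_le_mul (mul_le_mul_of_nonneg_left h1 cK_pos.le) (norm_w₁_le one_lt_two _) (norm_nonneg _)
    (mul_nonneg cK_pos.le (pow_nonneg h0 2))

/-- Socket `hint` of N0k at ANY exponent `κ` [folklore]: a bounded prefactor on a finite measure. -/
theorem hint_K (hκ : 0 < κ₁) (hG : ∀ Δ, Differentiable ℂ (G Δ)) (hB : ∀ Δ θ, ‖G Δ (circ (Real.exp κ₁) θ)‖ ≤ 1) (Z : Pol) (κ : ℝ) :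
    Integrable (fun ω => ‖preK G κ₁ Z ω‖ * Real.exp κ) (νK Z) :=
  Integrable.mono' (integrable_const (cK * (max (wB₁ (Real.exp κ₁)) 1) ^ 2 * wB₁ 2 * Real.exp κ))
    ((hpre_K hG Z).norm.mul aestronglyMeasurable_const)
    (Filter.Eventually.of_forall fun ω => by
      rw [Real.norm_of_nonneg (by positivity)]
      exact mul_le_mul_of_nonneg_right (norm_preK_le hκ hB Z ω) (Real.exp_pos κ).le)

/-- [folklore] Volume versus tree length on the catalogue: `#cubes₂ Z = d₂ Z + 1` ((1.25) p. 7 converts volume decay into tree-length decay; KIND). -/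
theorem card_cubes₂ (Z : Pol) : ((cubes₂ Z).card : ℝ) = d₂ Z + 1 := by
  cases Z <;> norm_num [cubes₂, d₂]

/-- **(B3) — THE (2.38)-SHAPE SOCKET `hL3` DERIVED, NOT CHOSEN** (kernel; for EVERY `κ₁ ≥ 1` and EVERY family of table-free cube factors bounded
by `1` ON the `σ(Δ)`-circle): at W29's dressed exponent `2·(1∕8 + 1·(1∕8)) = 1∕2`, `Σ_{j∈{Z}} ∫ ‖preK_j‖·e^{1∕2} dνK_j ≤ (1∕12)·e^{−(κ₁ − 1)·d₂ Z}`
— each cube letter pays `e^{κ₁}∕(e^{κ₁} − 1)² ≤ e^{−(κ₁−1)}` (§1), there are `d₂ Z + 1` of them, the polymer letter pays `2·e^{1∕2}`, `cK·2e^{1∕2} =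
1∕12` with `cK` d-FREE: the DECAY RATE `R = κ₁ − 1` is read off the contour radius, as in (2.15). -/
theorem hL3_K (hκ : 1 ≤ κ₁) (hB : ∀ Δ θ, ‖G Δ (circ (Real.exp κ₁) θ)‖ ≤ 1) :
    ∀ Z : Pol, cubes₂ Z ⊆ univ →
      ∑ j ∈ ({Z} : Finset Pol), ∫ ω, ‖preK G κ₁ j ω‖ * Real.exp (2 * (1 / 8 + 1 * (1 / 8))) ∂(νK j) ≤
        1 / 12 * Real.exp (-((κ₁ - 1) * d₂ Z)) := by
  intro Z _
  rw [Finset.sum_singleton]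
  have hκ0 : 0 < κ₁ := by linarith
  have hρ : 1 < Real.exp κ₁ := one_lt_rexp hκ0
  have hhalf : (2 : ℝ) * (1 / 8 + 1 * (1 / 8)) = 1 / 2 := by norm_num
  have h1 : ∀ ω : (Fin 2 → ℝ × ℝ) × (ℝ × ℝ), ‖preK G κ₁ Z ω‖ * Real.exp (2 * (1 / 8 + 1 * (1 / 8))) =
      (cK * ∏ Δ, ‖cf G κ₁ Z Δ (ω.1 Δ)‖) * (‖w₁ 2 ω.2‖ * Real.exp (1 / 2)) := fun ω => by
    rw [hhalf, preK, norm_mul, norm_mul, Complex.norm_real, Real.norm_of_nonneg cK_pos.le, norm_prod]; ring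
  simp_rw [h1]
  rw [νK, integral_prod_mul (f := fun p : Fin 2 → ℝ × ℝ => cK * ∏ Δ, ‖cf G κ₁ Z Δ (p Δ)‖)
    (g := fun q : ℝ × ℝ => ‖w₁ 2 q‖ * Real.exp (1 / 2)), integral_const_mul,
    integral_fintype_prod_eq_prod (𝕜 := ℝ) (fun Δ x => ‖cf G κ₁ Z Δ x‖)]
  -- each cube coordinate: the letter's majorant on a cube of `Z`, the filler's mass `1` outside
  have hcube : ∀ Δ, ∫ x, ‖cf G κ₁ Z Δ x‖ ∂(μc Z Δ) ≤
      if Δ ∈ cubes₂ Z then Real.exp κ₁ / (Real.exp κ₁ - 1) ^ 2 else 1 := by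
    intro Δ; unfold cf μc; split_ifs with h
    · simpa using cubeLetter_majorant_le hρ (hB Δ)
    · simp
  have hcube0 : ∀ Δ, 0 ≤ ∫ x, ‖cf G κ₁ Z Δ x‖ ∂(μc Z Δ) := fun Δ => integral_nonneg fun _ => norm_nonneg _
  have hprod : ∏ Δ, ∫ x, ‖cf G κ₁ Z Δ x‖ ∂(μc Z Δ) ≤ Real.exp (-((κ₁ - 1) * d₂ Z)) := by
    calc ∏ Δ, ∫ x, ‖cf G κ₁ Z Δ x‖ ∂(μc Z Δ)
        ≤ ∏ Δ, (if Δ ∈ cubes₂ Z then Real.exp κ₁ / (Real.exp κ₁ - 1) ^ 2 else 1) :=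
          Finset.prod_le_prod (fun Δ _ => hcube0 Δ) fun Δ _ => hcube Δ
      _ = (Real.exp κ₁ / (Real.exp κ₁ - 1) ^ 2) ^ (cubes₂ Z).card := by
          rw [Finset.prod_ite_mem, Finset.univ_inter, Finset.prod_const]
      _ ≤ Real.exp (-((κ₁ - 1) * (cubes₂ Z).card)) := decouplingFactor_pow_le hκ _
      _ ≤ Real.exp (-((κ₁ - 1) * d₂ Z)) := Real.exp_le_exp.2 (by rw [card_cubes₂]; nlinarith [hd₂ Z])
  -- the polymer letter
  have hpoly : ∫ q, ‖w₁ 2 q‖ * Real.exp (1 / 2) ∂lam₁ ≤ 2 * Real.exp (1 / 2) := by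
    have h := majorant_C_le one_lt_two (1 / 2); norm_num at h; exact h
  -- assemble
  have h3 : cK * ∏ Δ, ∫ x, ‖cf G κ₁ Z Δ x‖ ∂(μc Z Δ) ≤ cK * Real.exp (-((κ₁ - 1) * d₂ Z)) :=
    mul_le_mul_of_nonneg_left hprod cK_pos.le
  calc (cK * ∏ Δ, ∫ x, ‖cf G κ₁ Z Δ x‖ ∂(μc Z Δ)) * ∫ q, ‖w₁ 2 q‖ * Real.exp (1 / 2) ∂lam₁
      ≤ cK * Real.exp (-((κ₁ - 1) * d₂ Z)) * (2 * Real.exp (1 / 2)) :=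
        mul_le_mul h3 hpoly (integral_nonneg fun _ => by positivity) (mul_nonneg cK_pos.le (Real.exp_pos _).le)
    _ = 1 / 12 * Real.exp (-((κ₁ - 1) * d₂ Z)) := by
        have : Real.exp (1 / 2 : ℝ) ≠ 0 := (Real.exp_pos _).ne'
        unfold cK; field_simp; ring

/-! ## §3 THE END FIRES: N0k `muPart_locE_le_of_linearDressing` with `hL3` DERIVED, for all `κ₁ ≥ 6` and all admissible cube factors -/

/-- **N0k's END FIRES WITH THE DECAY EARNED BY THE CUBE LETTERS** (ONE application BY NAME; W23's sockets `hloc₂`∕`hd₂`∕`h126₂`∕`hvol₂`∕`h227₂`∕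
`hsmall₂` and W29's `norm_V₀M_le`∕`norm_OM_le`∕`hl_M` BY NAME; `hrep := hrep_K`, `hL3 := hL3_K` THEOREMS): for every `κ₁ ≥ 6` («κ₁ sufficiently
large» LOCATED for the catalogue: `hrate : 1 + 2·1 + 2 ≤ κ₁ − 1`) and every family `G` of table-free cube factors entire and bounded by `1` ON the
`σ(Δ)`-circle, at source radius `1`, for `0 < μ₀ < 1`, `‖μ‖ ≤ μ₀`: `‖E_μ(univ) − E_0(univ)‖ ≤ e·1·1·(3∕2)²·(1∕12)·e^{−1·1}·μ₀∕(1 − μ₀)`. -/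
theorem muPart_fires_K (hκ : 6 ≤ κ₁) (hG : ∀ Δ, Differentiable ℂ (G Δ)) (hB : ∀ Δ θ, ‖G Δ (circ (Real.exp κ₁) θ)‖ ≤ 1)
    {μ₀ : ℝ} {μ : ℂ} (h0 : 0 < μ₀) (h01 : μ₀ < 1) (hμ : ‖μ‖ ≤ μ₀) :
    ‖locE (polyInc on cubes₂) cubes₂ (actK G μ) univ - locE (polyInc on cubes₂) cubes₂ (actK G 0) univ‖ ≤
      Real.exp 1 * 1 * 1 * (3 / 2) ^ 2 * (1 / 12) * Real.exp (-(1 * 1)) * (μ₀ / (1 - μ₀)) :=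
  muPart_locE_le_of_linearDressing (polyInc on cubes₂) (reach := cubes₂) (d := d₂) (ν' := νK) (pre := preK G κ₁)
    (lin := linK) (l := fun _ _ => 2) (V₀ := V₀M) (O := OM) (terms := fun Z => {Z}) (act := actK G) (A := 1 / 12)
    (R := κ₁ - 1) (r₁ := 1) (κ₀ := 1) (K₀ := 3 / 2) (c₁ := 1) (c := 1) (b := 1) (ν := 1) (dX := 1) (μ₁ := 1) (ε₁ := 1 / 8)
    (b₀ := 1 / 8) hloc₂ (fun Z => by rw [one_mul]) hd₂ (by norm_num) (by norm_num) (by norm_num) (by norm_num) (by norm_num)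
    (by norm_num) (by norm_num) (by norm_num) h126₂ hvol₂ h227₂ (by linarith) hsmall₂ univ_nonempty
    (fun s _ Z => hrep_K (by linarith) hG s Z) (hpre_K hG) hlinw_K hl_K (fun Z => hint_K (by linarith) hG hB Z _)
    norm_V₀M_le norm_OM_le (by norm_num) (hL3_K (by linarith) hB) h0 h01 hμ

/-! ## §4 GENUINE on the DECIDED one-step factor `e^{−κ₁}·σ(Δ)`: the bound on the circle is TIGHT, the μ-part moves -/

/-- THE DECIDED TABLE-FREE FACTOR «one step through `Δ`»: `Gstep κ₁ Δ σ := e^{−κ₁}·σ` (a walk through the cube weighted `e^{−κ₁}`, the decoupling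
parameter counting the step — a TYPE reading of the random-walk expansions (1.10)∕(2.7), not their statement). -/
def Gstep (κ₁ : ℝ) (_Δ : Fin 2) (σ : ℂ) : ℂ := (Real.exp (-κ₁) : ℂ) * σ

/-- [folklore] It is entire (admissibility `hG`). -/
theorem differentiable_Gstep (κ₁ : ℝ) (Δ : Fin 2) : Differentiable ℂ (Gstep κ₁ Δ) :=
  differentiable_id.const_mul _

/-- **THE BOUND ON THE CIRCLE IS ATTAINED**: `‖Gstep κ₁ Δ σ‖ = 1` on the whole circle `|σ| = e^{κ₁}` — `hB` is TIGHT. [folklore] -/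
theorem norm_Gstep_circ (κ₁ : ℝ) (Δ : Fin 2) (θ : ℝ) : ‖Gstep κ₁ Δ (circ (Real.exp κ₁) θ)‖ = 1 := by
  rw [Gstep, norm_mul, Complex.norm_real, Real.norm_of_nonneg (Real.exp_pos _).le, norm_circ (Real.exp_pos _).le,
    ← Real.exp_add, neg_add_cancel, Real.exp_zero]

/-- Admissibility `hB` of the decided factor. [folklore] -/
theorem hB_Gstep (κ₁ : ℝ) : ∀ Δ θ, ‖Gstep κ₁ Δ (circ (Real.exp κ₁) θ)‖ ≤ 1 := fun Δ θ => (norm_Gstep_circ κ₁ Δ θ).le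

/-- [folklore] The coupled-minus-decoupled difference through a cube is the coupling `e^{−κ₁}`. -/
theorem Gstep_gap (κ₁ : ℝ) (Δ : Fin 2) : Gstep κ₁ Δ 1 - Gstep κ₁ Δ 0 = (Real.exp (-κ₁) : ℂ) := by simp [Gstep]

/-- **THE CUBE LETTER REPRODUCES THE COUPLING `e^{−κ₁}` WHILE ITS MAJORANT PAYS `e^{−(κ₁−1)}`** (§1 on the decided factor): print's loss is the
factor `e` per cube, its gain is never computing a derivative. -/
theorem cubeLetter_step (hκ : 0 < κ₁) (Δ : Fin 2) :
    ∫ x, w₁ (Real.exp κ₁) x * Gstep κ₁ Δ (circ (Real.exp κ₁) x.2) ∂lam₁ = (Real.exp (-κ₁) : ℂ) := by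
  rw [cubeLetter_rep hκ (differentiable_Gstep κ₁ Δ), Gstep_gap]

/-- **THE END ON THE DECIDED FACTOR, in closed numerals** (W23 `envelope₂_eq`): for every `κ₁ ≥ 6`, `‖E_μ(univ) − E_0(univ)‖ ≤ (3∕16)·μ₀∕(1 − μ₀)`. -/
theorem muPart_fires_step (hκ : 6 ≤ κ₁) {μ₀ : ℝ} {μ : ℂ} (h0 : 0 < μ₀) (h01 : μ₀ < 1) (hμ : ‖μ‖ ≤ μ₀) :
    ‖locE (polyInc on cubes₂) cubes₂ (actK (Gstep κ₁) μ) univ -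
        locE (polyInc on cubes₂) cubes₂ (actK (Gstep κ₁) 0) univ‖ ≤ 3 / 16 * (μ₀ / (1 - μ₀)) := by
  rw [← envelope₂_eq]; exact muPart_fires_K hκ (differentiable_Gstep κ₁) (hB_Gstep κ₁) h0 h01 hμ

/-- The activity on the decided factor at a REAL source, as a real number: `vK κ₁ μ Z = cK·(e^{−κ₁})^{#cubes₂ Z}·(e^{1∕8 + μ·oR Z} − 1)`. -/
def vK (κ₁ μ : ℝ) (Z : Pol) : ℝ := cK * Real.exp (-κ₁) ^ (cubes₂ Z).card * (Real.exp (1 / 8 + μ * oR Z) - 1)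

/-- [folklore] At a real source the activity on the decided factor is the real number `vK κ₁ μ Z`. -/
theorem actK_step_ofReal (κ₁ μ : ℝ) : actK (Gstep κ₁) (μ : ℂ) = fun Z => ((vK κ₁ μ Z : ℝ) : ℂ) := by
  funext Z
  simp only [actK, Gstep_gap, Finset.prod_const, vK, V₀M, OM, Pi.add_apply, Pi.smul_apply, smul_eq_mul]
  push_cast
  ring

/-- [folklore] `0 ≤ vK κ₁ μ Z` for `0 ≤ μ`. -/
theorem vK_nonneg (κ₁ : ℝ) {μ : ℝ} (hμ : 0 ≤ μ) (Z : Pol) : 0 ≤ vK κ₁ μ Z :=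
  mul_nonneg (mul_nonneg cK_pos.le (pow_nonneg (Real.exp_pos _).le _))
    (by have := (oR_mem Z).1; linarith [Real.add_one_le_exp (1 / 8 + μ * oR Z), mul_nonneg hμ this])

/-- [folklore] The coefficient of the pair polymer's Mayer factor is not zero: `cK·(e^{−κ₁})² ≠ 0`. -/
theorem coeff_p01_ne_zero (κ₁ : ℝ) : cK * Real.exp (-κ₁) ^ (cubes₂ p01).card ≠ 0 :=
  mul_ne_zero cK_pos.ne' (pow_ne_zero _ (Real.exp_pos _).ne')

/-- **THE μ-PART IS NOT ZERO ON THE DECIDED FACTOR** (END level; W25 `exp_locE_univ` BY NAME on the real nonnegative table `vK κ₁ μ`): for a real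
source `0 < μ` the small-field output at `univ` MOVES — §3 bounds a NON-ZERO quantity. -/
theorem locE_live_step (κ₁ : ℝ) {μ : ℝ} (hμ : 0 < μ) :
    locE (polyInc on cubes₂) cubes₂ (actK (Gstep κ₁) μ) univ ≠ locE (polyInc on cubes₂) cubes₂ (actK (Gstep κ₁) 0) univ := by
  intro h
  have h' := congrArg Complex.exp h
  rw [← Complex.ofReal_zero, actK_step_ofReal κ₁ μ, actK_step_ofReal κ₁ 0, exp_locE_univ (vK_nonneg κ₁ hμ.le),
    exp_locE_univ (vK_nonneg κ₁ le_rfl), Complex.ofReal_inj] at h'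
  have ha0 : vK κ₁ μ p0 = vK κ₁ 0 p0 := by simp [vK, oR]
  have ha1 : vK κ₁ μ p1 = vK κ₁ 0 p1 := by simp [vK, oR]
  rw [ha0, ha1] at h'
  have hpos : 0 < (1 + vK κ₁ 0 p0) * (1 + vK κ₁ 0 p1) := by
    have := vK_nonneg κ₁ le_rfl p0; have := vK_nonneg κ₁ le_rfl p1; positivity
  rw [div_left_inj' hpos.ne', add_right_inj] at h'
  have h2 : Real.exp (1 / 8 + μ * oR p01) = Real.exp (1 / 8 + 0 * oR p01) := by
    have := mul_left_cancel₀ (coeff_p01_ne_zero κ₁) h'; linarith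
  rw [Real.exp_eq_exp] at h2
  norm_num [oR] at h2
  exact hμ.ne' h2

end Summit.QuantumFields.BalabanUV.T4Continuum.NE1p.DressedSmallFieldCubeLetterWitness

end
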